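import Mathlib
import Summits.Ventures.PercRepro2.CoinChainAWorldLemmas

/-!
# The A-world decomposition for the GENERAL AND-switch chain — the lemmas
(blind cell PercRepro2, night-2 g19; proofs/NIGHT2-DARC.md §59.18)

The general chain: `a` entered from `ent ⊆ U` surely AND from `a'` by the coin; coin weight
`θ = chainTheta ent ent' ρ ∈ {0, ρ, 1}`.  This file: the coin-weight facts (`chainTheta_mono`,
`chainTheta_union_cases`, `one_sub_theta_facts_gen`), the three-region Holley inequality in
the coin weights alone (`aw_cross_AG_alg`: with `θ_∩ ≤ θ_s, θ_t ≤ θ_∪ ∈ {θ_s, θ_t}` and the two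
cross inequalities (X1)), the pointwise comparisons `A ≼ Ā` (`aw_cross_AR_gen`) and
`A ≼ Ā-gate` (`aw_cross_AG_gen`), and the **Ā-pair theorem** `abar_pair_nonneg_gen`:
`T(ν d, ν · chainMix ent ent' ρ d d') ≥ 0` — the gate is the convex combination
`(1 − ρ)·(world-1 gate, entries ent) + ρ·(world-1 gate, entries ent ∪ ent')`
(`chainMix_affine`, `chainMix_zero_eq_one_empty`), `T` is linear in the gate, and
`chain_world1_nonneg` applies to each.  The theorem is in `CoinChainAWorldGen.lean`.
-/

namespace Summit.Ventures.PercRepro2.Coin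

section ChainAWorldGenLemmas

variable {V : Type*} [DecidableEq V] {R : Type*} [Field R] [LinearOrder R] [IsStrictOrderedRing R]

omit [LinearOrder R] [IsStrictOrderedRing R] in
/-- The coin weight of the general chain is `1` on the clusters meeting `ent`, `ρ` on those
meeting `ent'` only, `0` otherwise. -/
lemma chainTheta_eq (ent ent' : Finset V) (ρ : R) (W : Finset V) :
    chainTheta ent ent' ρ W =
      if ∃ r ∈ ent, r ∈ W then 1 else if ∃ r ∈ ent', r ∈ W then ρ else 0 := rfl

/-- The coin weight is monotone along inclusion (for `0 ≤ ρ ≤ 1`). -/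
lemma chainTheta_mono (ent ent' : Finset V) {ρ : R} (hρ0 : 0 ≤ ρ) (hρ1 : ρ ≤ 1)
    {s t : Finset V} (hst : s ⊆ t) : chainTheta ent ent' ρ s ≤ chainTheta ent ent' ρ t := by
  rw [chainTheta_eq, chainTheta_eq]
  by_cases hs0 : ∃ r ∈ ent, r ∈ s
  · have ht0 : ∃ r ∈ ent, r ∈ t := by obtain ⟨r, hr, hrs⟩ := hs0; exact ⟨r, hr, hst hrs⟩
    rw [if_pos hs0, if_pos ht0]
  · rw [if_neg hs0]
    by_cases hs1 : ∃ r ∈ ent', r ∈ s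
    · have ht1 : ∃ r ∈ ent', r ∈ t := by obtain ⟨r, hr, hrs⟩ := hs1; exact ⟨r, hr, hst hrs⟩
      rw [if_pos hs1]; split_ifs <;> linarith
    · rw [if_neg hs1]; split_ifs <;> linarith

omit [LinearOrder R] [IsStrictOrderedRing R] in
/-- The coin weight of a union is the weight of one of the two clusters. -/
lemma chainTheta_union_cases (ent ent' : Finset V) (ρ : R) (s t : Finset V) :
    chainTheta ent ent' ρ (s ∪ t) = chainTheta ent ent' ρ s ∨
      chainTheta ent ent' ρ (s ∪ t) = chainTheta ent ent' ρ t := by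
  simp only [chainTheta_eq]
  have hu0 : (∃ r ∈ ent, r ∈ s ∪ t) ↔ (∃ r ∈ ent, r ∈ s) ∨ (∃ r ∈ ent, r ∈ t) := meets_union_iff
  have hu1 : (∃ r ∈ ent', r ∈ s ∪ t) ↔ (∃ r ∈ ent', r ∈ s) ∨ (∃ r ∈ ent', r ∈ t) :=
    meets_union_iff
  by_cases hs0 : ∃ r ∈ ent, r ∈ s <;> by_cases ht0 : ∃ r ∈ ent, r ∈ t <;>
    by_cases hs1 : ∃ r ∈ ent', r ∈ s <;> by_cases ht1 : ∃ r ∈ ent', r ∈ t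
  all_goals simp only [hu0, hu1, hs0, ht0, hs1, ht1, or_self, or_true, true_or, or_false,
    if_true, if_false]

/-- The coin weight `1 − chainTheta ent ent' ρ` lies in `[0, 1]`, is decreasing, and is
log-supermodular. -/
lemma one_sub_theta_facts_gen (ent ent' : Finset V) (ρ : R) (hρ0 : 0 ≤ ρ) (hρ1 : ρ ≤ 1) :
    (∀ W, 0 ≤ 1 - chainTheta ent ent' ρ W) ∧
    (∀ s t, 1 - chainTheta ent ent' ρ s ≤ 1 - chainTheta ent ent' ρ (s ∩ t)) ∧
    (∀ s t, (1 - chainTheta ent ent' ρ s) * (1 - chainTheta ent ent' ρ t) ≤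
      (1 - chainTheta ent ent' ρ (s ∩ t)) * (1 - chainTheta ent ent' ρ (s ∪ t))) := by
  refine ⟨fun W => by linarith [chainTheta_le_one ent ent' hρ1 W], fun s t => ?_, fun s t => ?_⟩
  · linarith [chainTheta_mono ent ent' hρ0 hρ1 (Finset.inter_subset_left : s ∩ t ⊆ s)]
  · have h1 := chainTheta_mono ent ent' hρ0 hρ1 (Finset.inter_subset_left : s ∩ t ⊆ s)
    have h2 := chainTheta_mono ent ent' hρ0 hρ1 (Finset.inter_subset_right : s ∩ t ⊆ t)
    have h3 := chainTheta_nonneg ent ent' hρ0 (s ∩ t)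
    have h4 := chainTheta_le_one ent ent' hρ1 (s ∪ t)
    have h5 := chainTheta_nonneg ent ent' hρ0 (s ∪ t)
    have hs1 := chainTheta_le_one ent ent' hρ1 s
    have ht1 := chainTheta_le_one ent ent' hρ1 t
    rcases chainTheta_union_cases ent ent' ρ s t with h | h
    · rw [h]; nlinarith
    · rw [h]; nlinarith

/-- The three-region Holley inequality in the coin weights alone: with `θ_∩ ≤ θ_s, θ_t ≤ θ_∪`,
`θ_∪ ∈ {θ_s, θ_t}` and the cross inequalities (X1) for `d` and `d'`. -/
lemma aw_cross_AG_alg (θs θt θi θu cs ds ci di dt dpt du dpu : R)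
    (hθi0 : 0 ≤ θi) (hθis : θi ≤ θs) (hθit : θi ≤ θt) (hθsu : θs ≤ θu) (hθtu : θt ≤ θu)
    (hθu1 : θu ≤ 1) (hu : θu = θs ∨ θu = θt)
    (hci : 0 ≤ ci - di) (hdu : 0 ≤ du) (hdpu : 0 ≤ dpu)
    (hX : (cs - ds) * dt ≤ (ci - di) * du) (hX' : (cs - ds) * dpt ≤ (ci - di) * dpu) :
    (1 - θs) * (cs - ds) * ((1 - θt) * dt + θt * dpt) ≤
      (1 - θi) * (ci - di) * ((1 - θu) * du + θu * dpu) := by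
  have hθs1 : θs ≤ 1 := le_trans hθsu hθu1
  have hθt1 : θt ≤ 1 := le_trans hθtu hθu1
  have hθt0 : 0 ≤ θt := le_trans hθi0 hθit
  have hθs0 : 0 ≤ θs := le_trans hθi0 hθis
  -- step 1: replace the `s, t` data by the `∩, ∪` data through (X1), (X1')
  have step1 : (1 - θs) * (cs - ds) * ((1 - θt) * dt + θt * dpt) ≤
      (1 - θs) * (ci - di) * ((1 - θt) * du + θt * dpu) := by
    have e1 := mul_le_mul_of_nonneg_left hX
      (mul_nonneg (by linarith) (by linarith) : (0 : R) ≤ (1 - θs) * (1 - θt))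
    have e2 := mul_le_mul_of_nonneg_left hX' (mul_nonneg (by linarith) hθt0 : (0 : R) ≤ (1 - θs) * θt)
    nlinarith [e1, e2]
  refine le_trans step1 ?_
  -- step 2: the coin weights
  rcases hu with h | h
  · -- θu = θs (so θt ≤ θs): F = du (1−θs)(θt−θi) + dpu [(1−θi)θs − (1−θs)θt] ≥ 0
    rw [h]
    have key : (1 - θi) * ((1 - θs) * du + θs * dpu) - (1 - θs) * ((1 - θt) * du + θt * dpu) =
        du * (1 - θs) * (θt - θi) + dpu * ((θs - θt) + θs * (θt - θi)) := by ring
    have hts : θt ≤ θs := h ▸ hθtu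
    have hF : 0 ≤ (1 - θi) * ((1 - θs) * du + θs * dpu) - (1 - θs) * ((1 - θt) * du + θt * dpu) := by
      rw [key]
      have t1 := mul_nonneg (mul_nonneg hdu (by linarith : (0 : R) ≤ 1 - θs))
        (by linarith : (0 : R) ≤ θt - θi)
      have t2 := mul_nonneg hdpu
        (add_nonneg (by linarith : (0 : R) ≤ θs - θt) (mul_nonneg hθs0 (by linarith : (0 : R) ≤ θt - θi)))
      linarith
    have hF' : (1 - θs) * ((1 - θt) * du + θt * dpu) ≤ (1 - θi) * ((1 - θs) * du + θs * dpu) := by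
      linarith
    calc (1 - θs) * (ci - di) * ((1 - θt) * du + θt * dpu)
        = (ci - di) * ((1 - θs) * ((1 - θt) * du + θt * dpu)) := by ring
      _ ≤ (ci - di) * ((1 - θi) * ((1 - θs) * du + θs * dpu)) := mul_le_mul_of_nonneg_left hF' hci
      _ = _ := by ring
  · -- θu = θt: (1 − θs) ≤ (1 − θi)
    rw [h]
    have : (1 - θs) * (ci - di) ≤ (1 - θi) * (ci - di) :=
      mul_le_mul_of_nonneg_right (by linarith) hci
    have hB' : 0 ≤ (1 - θt) * du + θt * dpu := by nlinarith
    exact mul_le_mul_of_nonneg_right this hB'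

/-- The `A`-weight `(1 − θ) · (c − d)` against the `Ā`-law `d` (pointwise Holley condition),
general chain. -/
lemma aw_cross_AR_gen (ent ent' : Finset V) (ρ : R) (hρ0 : 0 ≤ ρ) (hρ1 : ρ ≤ 1)
    (c d : Finset V → R) (hc0 : ∀ W, 0 ≤ c W) (hd0 : ∀ W, 0 ≤ d W)
    (hdc : ∀ W, d W ≤ c W) (hcc : ∀ s t, c s * c t ≤ c (s ∩ t) * c (s ∪ t))
    (hratio : ∀ s t, s ⊆ t → d s * c t ≤ c s * d t) (s t : Finset V) :
    (1 - chainTheta ent ent' ρ s) * (c s - d s) * d t ≤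
      (1 - chainTheta ent ent' ρ (s ∩ t)) * (c (s ∩ t) - d (s ∩ t)) * d (s ∪ t) := by
  have hX := cross_cd c d d hc0 hd0 hd0 hdc hdc hcc hratio hratio s t
  obtain ⟨hθ0, hθmono, -⟩ := one_sub_theta_facts_gen ent ent' ρ hρ0 hρ1
  calc (1 - chainTheta ent ent' ρ s) * (c s - d s) * d t
      = (1 - chainTheta ent ent' ρ s) * ((c s - d s) * d t) := by ring
    _ ≤ (1 - chainTheta ent ent' ρ (s ∩ t)) * ((c (s ∩ t) - d (s ∩ t)) * d (s ∪ t)) :=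
        mul_le_mul (hθmono s t) hX (mul_nonneg (by linarith [hdc s]) (hd0 t)) (hθ0 _)
    _ = _ := by ring

/-- The `A`-weight against the `Ā`-gate `chainMix ent ent' ρ d d'` (pointwise Holley
condition), general chain. -/
lemma aw_cross_AG_gen (ent ent' : Finset V) (ρ : R) (hρ0 : 0 ≤ ρ) (hρ1 : ρ ≤ 1)
    (c d d' : Finset V → R) (hc0 : ∀ W, 0 ≤ c W) (hd0 : ∀ W, 0 ≤ d W)
    (hd'0 : ∀ W, 0 ≤ d' W) (hdc : ∀ W, d W ≤ c W) (hd'd : ∀ W, d' W ≤ d W)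
    (hcc : ∀ s t, c s * c t ≤ c (s ∩ t) * c (s ∪ t))
    (hratio : ∀ s t, s ⊆ t → d s * c t ≤ c s * d t)
    (hratio' : ∀ s t, s ⊆ t → d' s * c t ≤ c s * d' t) (s t : Finset V) :
    (1 - chainTheta ent ent' ρ s) * (c s - d s) * chainMix ent ent' ρ d d' t ≤
      (1 - chainTheta ent ent' ρ (s ∩ t)) * (c (s ∩ t) - d (s ∩ t)) *
        chainMix ent ent' ρ d d' (s ∪ t) := by
  have hX := cross_cd c d d hc0 hd0 hd0 hdc hdc hcc hratio hratio s t
  have hX' := cross_cd c d d' hc0 hd0 hd'0 hdc (fun W => le_trans (hd'd W) (hdc W)) hcc hratio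
    hratio' s t
  unfold chainMix
  refine aw_cross_AG_alg (chainTheta ent ent' ρ s) (chainTheta ent ent' ρ t)
    (chainTheta ent ent' ρ (s ∩ t)) (chainTheta ent ent' ρ (s ∪ t)) (c s) (d s) (c (s ∩ t))
    (d (s ∩ t)) (d t) (d' t) (d (s ∪ t)) (d' (s ∪ t)) (chainTheta_nonneg ent ent' hρ0 _)
    (chainTheta_mono ent ent' hρ0 hρ1 Finset.inter_subset_left)
    (chainTheta_mono ent ent' hρ0 hρ1 Finset.inter_subset_right)
    (chainTheta_mono ent ent' hρ0 hρ1 Finset.subset_union_left)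
    (chainTheta_mono ent ent' hρ0 hρ1 Finset.subset_union_right)
    (chainTheta_le_one ent ent' hρ1 _) (chainTheta_union_cases ent ent' ρ s t)
    (by linarith [hdc (s ∩ t)]) (hd0 _) (hd'0 _) hX hX'

omit [LinearOrder R] [IsStrictOrderedRing R] in
/-- The mixture with equal values is the value: `chainMix ent ent' ρ d d = d`. -/
lemma chainMix_same (ent ent' : Finset V) (ρ : R) (d : Finset V → R) (W : Finset V) :
    chainMix ent ent' ρ d d W = d W := by
  unfold chainMix; ring

omit [LinearOrder R] [IsStrictOrderedRing R] in
/-- The world-0 mixture of `(d, d')` is the world-1 mixture with the entry set `ent` alone. -/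
lemma chainMix_zero_eq_one_empty (ent ent' : Finset V) (d d' : Finset V → R) (W : Finset V) :
    chainMix ent ent' 0 d d' W = chainMix ent ∅ 1 d d' W := by
  unfold chainMix chainTheta
  simp only [Finset.notMem_empty, false_and, exists_false, if_false]
  split_ifs <;> ring

/-- **The Ā-pair of the general chain is nonnegative**: `T(ν d, ν · chainMix ent ent' ρ d d') ≥ 0`
— the gate is `(1 − ρ)·(world-1 gate with entries ent) + ρ·(world-1 gate with entries
ent ∪ ent')` (`chainMix_affine`), `T` is linear in the gate, and `chain_world1_nonneg` applies
to each. -/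
theorem abar_pair_nonneg_gen (U ent ent' : Finset V) (ν d d' : Finset V → R)
    (ρ : R) (hρ0 : 0 ≤ ρ) (hρ1 : ρ ≤ 1) (hν0 : ∀ W, 0 ≤ ν W)
    (hν : ∀ s ⊆ U, ∀ t ⊆ U, ν s * ν t ≤ ν (s ∩ t) * ν (s ∪ t))
    (hd0 : ∀ W, 0 ≤ d W) (hd'0 : ∀ W, 0 ≤ d' W) (hd'd : ∀ W, d' W ≤ d W)
    (hdd : ∀ s t, d s * d t ≤ d (s ∩ t) * d (s ∪ t))
    (hd'd' : ∀ s t, d' s * d' t ≤ d' (s ∩ t) * d' (s ∪ t))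
    (hdd' : ∀ s t, d s * d' t ≤ d (s ∩ t) * d' (s ∪ t))
    (hratio'' : ∀ s t, s ⊆ t → d' s * d t ≤ d s * d' t) (m₁ m₂ : V) :
    0 ≤ (∑ W ∈ U.powerset, ν W * d W) ^ 2 *
          (∑ W ∈ U.powerset, ν W * chainMix ent ent' ρ d d' W *
            ((if m₁ ∈ W then (1 : R) else 0) * (if m₂ ∈ W then (1 : R) else 0)))
        - (∑ W ∈ U.powerset, ν W * d W) *
          (∑ W ∈ U.powerset, ν W * d W * (if m₁ ∈ W then (1 : R) else 0)) *
          (∑ W ∈ U.powerset, ν W * chainMix ent ent' ρ d d' W * (if m₂ ∈ W then (1 : R) else 0))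
        - (∑ W ∈ U.powerset, ν W * d W) *
          (∑ W ∈ U.powerset, ν W * d W * (if m₂ ∈ W then (1 : R) else 0)) *
          (∑ W ∈ U.powerset, ν W * chainMix ent ent' ρ d d' W * (if m₁ ∈ W then (1 : R) else 0))
        + (∑ W ∈ U.powerset, ν W * d W * (if m₁ ∈ W then (1 : R) else 0)) *
          (∑ W ∈ U.powerset, ν W * d W * (if m₂ ∈ W then (1 : R) else 0)) *
          (∑ W ∈ U.powerset, ν W * chainMix ent ent' ρ d d' W) := by
  -- the two world-1 instances
  have h1 := chain_world1_nonneg U ent ent' ν d d d' ρ hρ0 hρ1 hν0 hν hd0 hd0 hd'0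
    (fun W => le_refl _) hd'd hdd hdd hd'd' hdd hdd' hdd' (fun s t _ => le_refl _)
    hratio'' m₁ m₂
  have h0 := chain_world1_nonneg U ent ∅ ν d d d' ρ hρ0 hρ1 hν0 hν hd0 hd0 hd'0
    (fun W => le_refl _) hd'd hdd hdd hd'd' hdd hdd' hdd' (fun s t _ => le_refl _)
    hratio'' m₁ m₂
  simp only [chainMix_same] at h1 h0
  -- linearity of the gate in ρ
  have e : ∀ W, ν W * chainMix ent ent' ρ d d' W =
      (1 - ρ) * (ν W * chainMix ent ∅ 1 d d' W) + ρ * (ν W * chainMix ent ent' 1 d d' W) := by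
    intro W
    rw [chainMix_affine ent ent' ρ d d' W, chainMix_zero_eq_one_empty]; ring
  have eM : ∀ f : Finset V → R, ∑ W ∈ U.powerset, ν W * chainMix ent ent' ρ d d' W * f W =
      (1 - ρ) * ∑ W ∈ U.powerset, ν W * chainMix ent ∅ 1 d d' W * f W +
      ρ * ∑ W ∈ U.powerset, ν W * chainMix ent ent' 1 d d' W * f W := by
    intro f
    rw [Finset.mul_sum, Finset.mul_sum, ← Finset.sum_add_distrib]
    exact Finset.sum_congr rfl fun W _ => by rw [e W]; ring
  have eM0 : ∑ W ∈ U.powerset, ν W * chainMix ent ent' ρ d d' W =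
      (1 - ρ) * ∑ W ∈ U.powerset, ν W * chainMix ent ∅ 1 d d' W +
      ρ * ∑ W ∈ U.powerset, ν W * chainMix ent ent' 1 d d' W := by
    rw [Finset.mul_sum, Finset.mul_sum, ← Finset.sum_add_distrib]
    exact Finset.sum_congr rfl fun W _ => by rw [e W]
  rw [eM0, eM (fun W => if m₁ ∈ W then (1 : R) else 0), eM (fun W => if m₂ ∈ W then (1 : R) else 0),
    eM (fun W => (if m₁ ∈ W then (1 : R) else 0) * (if m₂ ∈ W then (1 : R) else 0))]
  have hρ' : (0 : R) ≤ 1 - ρ := by linarith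
  nlinarith [mul_le_mul_of_nonneg_left h1 hρ0, mul_le_mul_of_nonneg_left h0 hρ']

/-- `chainMix ent ent' ρ d d' ≤ d` when `d' ≤ d`. -/
lemma chainMix_dd'_le_gen (ent ent' : Finset V) (ρ : R) (hρ0 : 0 ≤ ρ)
    (d d' : Finset V → R) (hd'd : ∀ W, d' W ≤ d W) (W : Finset V) :
    chainMix ent ent' ρ d d' W ≤ d W := by
  unfold chainMix
  have := chainTheta_nonneg ent ent' hρ0 W
  nlinarith [hd'd W]

/-- `chainMix ent ent' ρ d d' ≥ 0`. -/
lemma chainMix_dd'_nonneg_gen (ent ent' : Finset V) (ρ : R) (hρ0 : 0 ≤ ρ) (hρ1 : ρ ≤ 1)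
    (d d' : Finset V → R) (hd0 : ∀ W, 0 ≤ d W) (hd'0 : ∀ W, 0 ≤ d' W) (W : Finset V) :
    0 ≤ chainMix ent ent' ρ d d' W :=
  chainMix_nonneg ent ent' hρ0 hρ1 hd0 hd'0 W

end ChainAWorldGenLemmas

end Summit.Ventures.PercRepro2.Coin
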